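import Summits.BirchSwinnertonDyer.Rank1Residual.X11b.BDPRouteOddPrime
import Literature.NumberTheory.EllipticCurves.Rank1Residual.X11Three
import HarnessLib

/-!
# Class X11b, route "BDP + converse-theorem engine + Kolyvagin" at EVERY ODD PRIME — class level and `p = 3` (cell `b2b-bsdres`, sub-cell `multr1-p2`, gen 4)

HONEST FRAMING (cell `b2b-bsdres`, run/shared/lean/b2b/bsd-rank1-residual/, verbatim in every
file): the goal of the cell is to DELETE the COMBINATION-SHAPED residual classes of the
Birch–Swinnerton-Dyer formula for ALL analytic-rank `≤ 1` elliptic curves over `ℚ` — "full BSD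
formula for every rank `≤ 1` curve in class `C`" assembled STRICTLY from published theorems — so
that the rank-`≤ 1` remainder becomes exactly the CONSTRUCTION-SHAPED classes, which are TYPED
(missing-input `Prop`s), NOT attempted. This is not "finishing BSD". Sub-cell `multr1-p2` is a
RESEARCH ROUTE on class X11b (`ClassX11b W p := r_an = 1 ∧ p ≠ 2 ∧ mult(p) ∧ irr(p)`,
`Partition/Rows.lean`); no claim beyond the stated class and loci; X11b's label does not change.

THEOREMS ONLY (no definition, no named fact). The data-level odd-prime theorems are
`X11b/BDPRouteOddPrime.lean` (transport (d) at odd `p` with `d_K` odd: eisenstein-p2's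
`X2.padicValNat_tamagawaProduct_twist_of_heegner_of_odd`; Hoffstein–Luo field with `d_K ≡ 1 (mod 8)`,
`d_K < −4`: x1a's `exists_admissibleField_of_rootNumber_eq_neg_one`). Here: the class-level
assembly at EVERY ODD PRIME, extending the `p ≥ 5` theorems of `BDPRouteHalvesClass.lean`,
`BDPRouteTamagawaDefect.lean`, `BDPRouteUpperLever.lean`, `BDPRouteManin.lean` to `p = 3`.
The ten PUBLISHED named facts are `hGZ` Gross–Zagier, `hKo`/`hB` Kolyvagin (qualitative / Thm. A,
`ρ̄_{E,p}` onto by `surj_of_irr_of_ram`), `hSk` Skinner 2016 Thm. C (`p ≥ 3`, footnote 1), `hGZK`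
Gross–Zagier–Kolyvagin over `ℚ`, `hmod`/`hnf` modularity, `hHL` Hoffstein–Luo 1997, `hMaz` Mazur
1978 Cor. 4.1, `hNS` Néron mapping property:
* `missingUpperBoundAt_of_classX11b_of_ram_of_not_dvd` — **UNCONDITIONAL**: for EVERY `(E,p)` of
  X11b (any odd `p`) with a (ram) prime and `p ∤ ∏_ℓ c_ℓ(E)`, the Euler-system half
  `ord_p #Ш(E) ≤ ord_p #Ш(E)_an` (`Typed.MissingUpperBoundAt`);
* `padicValNat_shaOrder_le_add_of_classX11b_of_ram_odd` — **UNCONDITIONAL**: for every `(E,p)` of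
  X11b with a (ram) prime (ANY Tamagawa numbers), `#Ш(E)_an = q ∈ ℚ` with
  `ord_p #Ш(E) ≤ ord_p q + 2·ord_p ∏_ℓ c_ℓ(E)` (Kolyvagin's Tamagawa defect, exact);
* `missingLowerBoundAt_of_classX11b_of_ram_odd` — STEP L (the route's ONE typed input
  `IndexLowerBoundAt`, OPEN at `p ∥ N`, at the Manin-good Heegner data of X11b ∧ (ram) pairs) ⇒ the
  main-conjecture half on X11b ∧ (ram), any odd `p`, no Tamagawa condition;
* `bsdp_of_classX11b_of_ram_of_not_dvd` — STEP L ⇒ full `BSD(E,p)` on X11b ∧ (ram) ∧ `p ∤ ∏c_ℓ`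
  at every odd `p`; `statement_of_indexLowerBoundAt_odd` — in particular the target of record
  `X11b.Statement`; `bsdp_of_classX11b_of_ram_of_padicValRat_shaAn_le` — the certificate case
  (`ord_p #Ш_an ≤ 0` ⇒ `BSD(E,p)`, published facts alone);
* `p = 3` in the vocabulary of the cell's typed class `IsX11Three` (`mult(3) ∧ irr(3) ∧ r = 1`,
  `Rank1Residual/X11Three.lean`, ruled CONSTRUCTION-SHAPED, REFEREE R6.2):
  `IsX11Three.missingUpperBoundAt_of_ram_of_not_dvd` (UNCONDITIONAL),
  `IsX11Three.padicValNat_shaOrder_le_add_of_ram` (UNCONDITIONAL),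
  `IsX11Three.bsdp_of_ram_of_not_dvd_of_indexLowerBoundAt` (⇐ STEP L at `p = 3`).

WHERE IT BITES (census, numbers not adjectives; x11b seat `x11b_p3_r1_pairs.tsv`, `N < 10⁴`): of the
111 `IsX11Three` pairs (44 semistable), 108 have a (ram) prime, 24 of them `3 ∤ ∏c_ℓ` (13 with
`N ≥ 5000`, i.e. outside Miller 2011's printed range), 84 have `3 ∣ ∏c_ℓ` (defect bound only), 3 have
no (ram) prime (nothing from this route). STEP L at `p = 3` is further from print than at `p ≥ 5`
(Castella's `p ∥ N` `p`-adic Waldspurger formula and Howard's big Heegner points are printed for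
`p ≥ 5` / `p ∤ 6N` — `Typed/X11Three.lean` docstring); it enters here only as the typed predicate.
Nothing is booked by these theorems; X11b and X11 (`p = 3`) stay CONSTRUCTION-SHAPED.

References: [JetchevSkinnerWan2017] §7.4.1–7.4.3 (pp. 29–31); [Skinner2016PacificMC] Thm. C,
footnote 1, §2.5; [KolyvaginEulerSystems1990] Thm. A; [McCallumLMS1991] §1; [GrossLMS1991] Prop. 2.1;
[Mazur1978] Cor. 4.1; [HoffsteinLuo1997] Theorem (§1); [Serre1972] Prop. 15; [Miller2011LMS] Def. 1.1.
-/

noncomputable section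

open scoped Classical

open WeierstrassCurve NumberField Literature.NumberTheory.EllipticCurves
  Literature.NumberTheory.EllipticCurves.ModularForms
  Literature.NumberTheory.EllipticCurves.Rank1Residual

namespace Summit.BirchSwinnertonDyer.Rank1Residual.X11b

/-! ### Class level, every odd prime -/

/-- **The Euler-system half of `BSD(E,p)` on X11b ∧ (ram) ∧ `p ∤ ∏c_ℓ` — EVERY ODD PRIME,
UNCONDITIONAL (published named facts only).** For every `(E,p)` in X11b (`r_an = 1`, `p` odd,
multiplicative at `p`, `E[p]` irreducible) with a (ram) prime and `p ∤ ∏_ℓ c_ℓ(E)`: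
`ord_p #Ш(E) ≤ ord_p #Ш(E)_an` (`Typed.MissingUpperBoundAt W p`). Inputs: Gross–Zagier (`hGZ`),
Kolyvagin (`hKo`; Thm. A `hB`, `ρ̄_{E,p}` onto by `surj_of_irr_of_ram`), Skinner 2016 Thm. C (`hSk`,
`p ≥ 3`, for the twist), Gross–Zagier–Kolyvagin over `ℚ` (`hGZK`), modularity (`hmod`, `hnf`),
Hoffstein–Luo 1997 (`hHL`), Mazur 1978 Cor. 4.1 (`hMaz`), Néron mapping property (`hNS`). Extends
`missingUpperBoundAt_of_classX11b_of_locus` (`p ≥ 5`) to `p = 3`. Nothing booked; labels unchanged.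
[cite: JetchevSkinnerWan2017, §7.4.2 (p. 31)] [cite: McCallumLMS1991, §1 Theorem (Kolyvagin), p. 296]
[cite: Skinner2016PacificMC, Thm. C (§1) and footnote 1] [cite: HoffsteinLuo1997, Theorem (§1)]
[cite: Mazur1978, Cor. 4.1] [cite: Miller2011LMS, Def. 1.1] -/
theorem missingUpperBoundAt_of_classX11b_of_ram_of_not_dvd
    -- published inputs (named facts of the tree)
    (hGZ : ∀ (N : ℕ) [NeZero N] (W : WeierstrassCurve ℚ) (K : Type) [Field K] [NumberField K],
      gross_zagier N W K)
    (hKo : ∀ (N : ℕ) [NeZero N] (W : WeierstrassCurve ℚ) (K : Type) [Field K] [NumberField K],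
      kolyvagin N W K)
    (hB : ∀ (N : ℕ) [NeZero N] (W : WeierstrassCurve ℚ) (K : Type) [Field K] [NumberField K],
      Kolyvagin1990_padicValNat_card_sha_le N W K)
    (hSk : Skinner2016.thmC_padicValRat_bsd_rank_zero)
    (hGZK : rank_eq_analyticRank_of_analyticRank_le_one) (hmod : hasEntireLFunction_rat)
    (hnf : exists_isNewformOf) (hHL : HoffsteinLuo1997_exists_twist_L_one_ne_zero)
    (hMaz : mazur_not_dvd_maninConstant_of_odd) (hNS : integral_neronScaling_of_isGloballyMinimal) :
    ∀ (W : WeierstrassCurve ℚ) [W.IsElliptic] [W.IsGloballyMinimal] (p : ℕ) [Fact p.Prime],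
      ClassX11b W p → Ram W p → ¬ p ∣ W.tamagawaProduct → Typed.MissingUpperBoundAt W p := by
  intro W _ _ p _ hX hram htam0
  have hp : p.Prime := Fact.out
  obtain ⟨hr, hp2, hmult, hirr⟩ := hX
  haveI : NeZero (W.conductorNorm ℤ) := ⟨(W.conductorNorm_pos_holds).ne'⟩
  obtain ⟨K, _, _, Dt, H, ι, P, Wd, _, _, Cd, hK, hodd, hpd, hHN, hP, hc, hμ, hLt, hWd⟩ :=
    exists_oddHeegnerData hnf hHL hMaz hNS W p hr hp2 hmult hirr
  -- Kolyvagin's bound (`ρ̄_{E,p}` surjective from irr + ram)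
  have hsurj : Surj W p := surj_of_irr_of_ram W p hirr hram
  have hU : Finite (W.baseChange K).sha → ¬ IsOfFinAddOrder P →
      padicValNat p (Nat.card (W.baseChange K).sha) ≤
        2 * padicValNat p (AddSubgroup.zmultiples P).index :=
    fun _ hnt ↦ hB _ W K hK hHN ⟨Dt, H, ι, hP⟩ hnt hp hp2 hsurj
  exact (halves_of_heegnerData_of_odd W p K Dt H ι P (hGZ _ W K) (hKo _ W K) hSk hGZK hmod hr hp2
    hmult hirr hram hK hodd hpd hHN hP hc hμ hLt Wd Cd hWd).2 htam0 hU

/-- **Kolyvagin's Tamagawa defect, exactly, on X11b ∧ (ram) — EVERY ODD PRIME, UNCONDITIONAL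
(published named facts only).** For every `(E,p)` in X11b with a (ram) prime (ANY Tamagawa numbers):
`#Ш(E)_an` is a rational `q` with `ord_p #Ш(E) ≤ ord_p q + 2·ord_p ∏_ℓ c_ℓ(E)`. Same ten published
inputs as `missingUpperBoundAt_of_classX11b_of_ram_of_not_dvd`. Extends
`padicValNat_shaOrder_le_add_of_classX11b_of_ram` (`p ≥ 5`) to `p = 3`. Nothing booked.
[cite: JetchevSkinnerWan2017, §7.4.2 (p. 31)] [cite: McCallumLMS1991, §1 Theorem (Kolyvagin), p. 296]
[cite: Skinner2016PacificMC, Thm. C (§1) and footnote 1] [cite: HoffsteinLuo1997, Theorem (§1)]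
[cite: Miller2011LMS, Def. 1.1] -/
theorem padicValNat_shaOrder_le_add_of_classX11b_of_ram_odd
    -- published inputs (named facts of the tree)
    (hGZ : ∀ (N : ℕ) [NeZero N] (W : WeierstrassCurve ℚ) (K : Type) [Field K] [NumberField K],
      gross_zagier N W K)
    (hKo : ∀ (N : ℕ) [NeZero N] (W : WeierstrassCurve ℚ) (K : Type) [Field K] [NumberField K],
      kolyvagin N W K)
    (hB : ∀ (N : ℕ) [NeZero N] (W : WeierstrassCurve ℚ) (K : Type) [Field K] [NumberField K],
      Kolyvagin1990_padicValNat_card_sha_le N W K)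
    (hSk : Skinner2016.thmC_padicValRat_bsd_rank_zero)
    (hGZK : rank_eq_analyticRank_of_analyticRank_le_one) (hmod : hasEntireLFunction_rat)
    (hnf : exists_isNewformOf) (hHL : HoffsteinLuo1997_exists_twist_L_one_ne_zero)
    (hMaz : mazur_not_dvd_maninConstant_of_odd) (hNS : integral_neronScaling_of_isGloballyMinimal) :
    ∀ (W : WeierstrassCurve ℚ) [W.IsElliptic] [W.IsGloballyMinimal] (p : ℕ) [Fact p.Prime],
      ClassX11b W p → Ram W p →
        ∃ q : ℚ, shaAn W = (q : ℂ) ∧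
          (padicValNat p W.shaOrder : ℤ) ≤ padicValRat p q + 2 * padicValNat p W.tamagawaProduct := by
  intro W _ _ p _ hX hram
  have hp : p.Prime := Fact.out
  obtain ⟨hr, hp2, hmult, hirr⟩ := hX
  haveI : NeZero (W.conductorNorm ℤ) := ⟨(W.conductorNorm_pos_holds).ne'⟩
  obtain ⟨K, _, _, Dt, H, ι, P, Wd, _, _, Cd, hK, hodd, hpd, hHN, hP, hc, hμ, hLt, hWd⟩ :=
    exists_oddHeegnerData hnf hHL hMaz hNS W p hr hp2 hmult hirr
  have hsurj : Surj W p := surj_of_irr_of_ram W p hirr hram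
  exact padicValNat_shaOrder_le_add_of_heegnerData_of_odd W p K Dt H ι P (hGZ _ W K) (hKo _ W K) hSk
    hGZK hmod hr hp2 hmult hirr hram hK hodd hpd hHN hP hc hμ hLt Wd Cd hWd
    (fun _ hnt ↦ hB _ W K hK hHN ⟨Dt, H, ι, hP⟩ hnt hp hp2 hsurj)

/-- **The main-conjecture half of `BSD(E,p)` from STEP L on X11b ∧ (ram) — EVERY ODD PRIME, no
Tamagawa condition.** For every `(E,p)` in X11b with a (ram) prime: STEP L (`hL`: the route's typed
input `IndexLowerBoundAt`, OPEN at `p ∥ N`, at every Manin-good Heegner datum of such pairs) and the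
nine PUBLISHED facts `hGZ`, `hKo`, `hSk`, `hGZK`, `hmod`, `hnf`, `hHL`, `hMaz`, `hNS` imply
`ord_p #Ш(E)_an ≤ ord_p #Ш(E)` (`Typed.MissingLowerBoundAt W p`). Extends
`missingLowerBoundAt_of_classX11b_of_ram` (`p ≥ 5`) to `p = 3`. CONDITIONAL on STEP L; nothing booked.
[cite: JetchevSkinnerWan2017, §7.4.1 (pp. 30–31)] [cite: Skinner2016PacificMC, Thm. C (§1) and footnote 1]
[cite: HoffsteinLuo1997, Theorem (§1)] [cite: Mazur1978, Cor. 4.1] [cite: Miller2011LMS, Def. 1.1] -/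
theorem missingLowerBoundAt_of_classX11b_of_ram_odd
    -- published inputs (named facts of the tree)
    (hGZ : ∀ (N : ℕ) [NeZero N] (W : WeierstrassCurve ℚ) (K : Type) [Field K] [NumberField K],
      gross_zagier N W K)
    (hKo : ∀ (N : ℕ) [NeZero N] (W : WeierstrassCurve ℚ) (K : Type) [Field K] [NumberField K],
      kolyvagin N W K)
    (hSk : Skinner2016.thmC_padicValRat_bsd_rank_zero)
    (hGZK : rank_eq_analyticRank_of_analyticRank_le_one) (hmod : hasEntireLFunction_rat)
    (hnf : exists_isNewformOf) (hHL : HoffsteinLuo1997_exists_twist_L_one_ne_zero)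
    (hMaz : mazur_not_dvd_maninConstant_of_odd) (hNS : integral_neronScaling_of_isGloballyMinimal)
    -- the typed input of the route (STEP L), at every Heegner datum with Manin constant prime to `p`
    (hL : ∀ (W : WeierstrassCurve ℚ) [W.IsElliptic] [W.IsGloballyMinimal] (p : ℕ) [Fact p.Prime]
      (N : ℕ) [NeZero N] (K : Type) [Field K] [NumberField K]
      (Dt : ModularParametrizationData W N) (H : HeegnerDatum N (NumberField.discr K)) (ι : K →+* ℂ)
      (P : (W.baseChange K).toAffine.Point),
      ClassX11b W p → Ram W p → W.conductorNorm ℤ = N → IsImaginaryQuadratic K →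
      SatisfiesHeegnerHypothesis N K →
      WeierstrassCurve.Affine.Point.map ι.toRatAlgHom P = heegnerPointComplex Dt H →
      ¬ (p : ℤ) ∣ Dt.c → IndexLowerBoundAt W p K P) :
    ∀ (W : WeierstrassCurve ℚ) [W.IsElliptic] [W.IsGloballyMinimal] (p : ℕ) [Fact p.Prime],
      ClassX11b W p → Ram W p → Typed.MissingLowerBoundAt W p := by
  intro W _ _ p _ hX hram
  have hX' := hX
  obtain ⟨hr, hp2, hmult, hirr⟩ := hX
  haveI : NeZero (W.conductorNorm ℤ) := ⟨(W.conductorNorm_pos_holds).ne'⟩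
  obtain ⟨K, _, _, Dt, H, ι, P, Wd, _, _, Cd, hK, hodd, hpd, hHN, hP, hc, hμ, hLt, hWd⟩ :=
    exists_oddHeegnerData hnf hHL hMaz hNS W p hr hp2 hmult hirr
  exact (halves_of_heegnerData_of_odd W p K Dt H ι P (hGZ _ W K) (hKo _ W K) hSk hGZK hmod hr hp2
    hmult hirr hram hK hodd hpd hHN hP hc hμ hLt Wd Cd hWd).1
    (hL W p _ K Dt H ι P hX' hram rfl hK hHN hP hc)

/-- **Full `BSD(E,p)` from STEP L on X11b ∧ (ram) ∧ `p ∤ ∏c_ℓ` — EVERY ODD PRIME.** Upper half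
unconditional (`missingUpperBoundAt_of_classX11b_of_ram_of_not_dvd`), lower half from STEP L
(`missingLowerBoundAt_of_classX11b_of_ram_odd`), recombined by `bsdp_of_halves`. At `p ≥ 5` this is
the route's `Locus` (`bsdp_of_classX11b_of_locus`); new at `p = 3`. CONDITIONAL on STEP L; nothing booked.
[cite: JetchevSkinnerWan2017, §7.4.1–7.4.3 (pp. 30–31)] [cite: Miller2011LMS, Def. 1.1] -/
theorem bsdp_of_classX11b_of_ram_of_not_dvd
    -- published inputs (named facts of the tree)
    (hGZ : ∀ (N : ℕ) [NeZero N] (W : WeierstrassCurve ℚ) (K : Type) [Field K] [NumberField K],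
      gross_zagier N W K)
    (hKo : ∀ (N : ℕ) [NeZero N] (W : WeierstrassCurve ℚ) (K : Type) [Field K] [NumberField K],
      kolyvagin N W K)
    (hB : ∀ (N : ℕ) [NeZero N] (W : WeierstrassCurve ℚ) (K : Type) [Field K] [NumberField K],
      Kolyvagin1990_padicValNat_card_sha_le N W K)
    (hSk : Skinner2016.thmC_padicValRat_bsd_rank_zero)
    (hGZK : rank_eq_analyticRank_of_analyticRank_le_one) (hmod : hasEntireLFunction_rat)
    (hnf : exists_isNewformOf) (hHL : HoffsteinLuo1997_exists_twist_L_one_ne_zero)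
    (hMaz : mazur_not_dvd_maninConstant_of_odd) (hNS : integral_neronScaling_of_isGloballyMinimal)
    -- the typed input of the route (STEP L), at every Heegner datum with Manin constant prime to `p`
    (hL : ∀ (W : WeierstrassCurve ℚ) [W.IsElliptic] [W.IsGloballyMinimal] (p : ℕ) [Fact p.Prime]
      (N : ℕ) [NeZero N] (K : Type) [Field K] [NumberField K]
      (Dt : ModularParametrizationData W N) (H : HeegnerDatum N (NumberField.discr K)) (ι : K →+* ℂ)
      (P : (W.baseChange K).toAffine.Point),
      ClassX11b W p → Ram W p → W.conductorNorm ℤ = N → IsImaginaryQuadratic K →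
      SatisfiesHeegnerHypothesis N K →
      WeierstrassCurve.Affine.Point.map ι.toRatAlgHom P = heegnerPointComplex Dt H →
      ¬ (p : ℤ) ∣ Dt.c → IndexLowerBoundAt W p K P) :
    ∀ (W : WeierstrassCurve ℚ) [W.IsElliptic] [W.IsGloballyMinimal] (p : ℕ) [Fact p.Prime],
      ClassX11b W p → Ram W p → ¬ p ∣ W.tamagawaProduct → BSDp W p := by
  intro W _ _ p _ hX hram htam0
  exact bsdp_of_halves hGZK W p (le_of_eq hX.1)
    (missingLowerBoundAt_of_classX11b_of_ram_odd hGZ hKo hSk hGZK hmod hnf hHL hMaz hNS hL W p hX hram)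
    (missingUpperBoundAt_of_classX11b_of_ram_of_not_dvd hGZ hKo hB hSk hGZK hmod hnf hHL hMaz hNS W p
      hX hram htam0)

/-- **The sub-cell target of record `X11b.Statement` from STEP L (odd-prime assembly).** `Locus`
(`5 ≤ p ∧ Ram ∧ p ∤ ∏c_ℓ`) is contained in the domain of `bsdp_of_classX11b_of_ram_of_not_dvd`; same
published inputs, with Hoffstein–Luo's field in place of Friedberg–Hoffstein's
(cf. `statement_of_indexLowerBoundAt`, `statement_of_indexLowerBoundAt'`). CONDITIONAL on STEP L.
[cite: JetchevSkinnerWan2017, §7.4.1–7.4.3 (pp. 30–31)] [cite: Miller2011LMS, Def. 1.1] -/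
theorem statement_of_indexLowerBoundAt_odd
    -- published inputs (named facts of the tree)
    (hGZ : ∀ (N : ℕ) [NeZero N] (W : WeierstrassCurve ℚ) (K : Type) [Field K] [NumberField K],
      gross_zagier N W K)
    (hKo : ∀ (N : ℕ) [NeZero N] (W : WeierstrassCurve ℚ) (K : Type) [Field K] [NumberField K],
      kolyvagin N W K)
    (hB : ∀ (N : ℕ) [NeZero N] (W : WeierstrassCurve ℚ) (K : Type) [Field K] [NumberField K],
      Kolyvagin1990_padicValNat_card_sha_le N W K)
    (hSk : Skinner2016.thmC_padicValRat_bsd_rank_zero)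
    (hGZK : rank_eq_analyticRank_of_analyticRank_le_one) (hmod : hasEntireLFunction_rat)
    (hnf : exists_isNewformOf) (hHL : HoffsteinLuo1997_exists_twist_L_one_ne_zero)
    (hMaz : mazur_not_dvd_maninConstant_of_odd) (hNS : integral_neronScaling_of_isGloballyMinimal)
    (hL : ∀ (W : WeierstrassCurve ℚ) [W.IsElliptic] [W.IsGloballyMinimal] (p : ℕ) [Fact p.Prime]
      (N : ℕ) [NeZero N] (K : Type) [Field K] [NumberField K]
      (Dt : ModularParametrizationData W N) (H : HeegnerDatum N (NumberField.discr K)) (ι : K →+* ℂ)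
      (P : (W.baseChange K).toAffine.Point),
      ClassX11b W p → Ram W p → W.conductorNorm ℤ = N → IsImaginaryQuadratic K →
      SatisfiesHeegnerHypothesis N K →
      WeierstrassCurve.Affine.Point.map ι.toRatAlgHom P = heegnerPointComplex Dt H →
      ¬ (p : ℤ) ∣ Dt.c → IndexLowerBoundAt W p K P) :
    Statement := by
  intro W _ _ p _ hX hloc
  exact bsdp_of_classX11b_of_ram_of_not_dvd hGZ hKo hB hSk hGZK hmod hnf hHL hMaz hNS hL W p hX
    hloc.2.1 hloc.2.2

/-- **The certificate case at an odd prime: `ord_p #Ш(E)_an ≤ 0` ⇒ `BSD(E,p)` on X11b ∧ (ram) ∧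
`p ∤ ∏c_ℓ`, from published facts alone** (as `bsdp_of_classX11b_of_locus_of_padicValRat_shaAn_le`,
now for every odd `p`): the unconditional upper half gives `ord_p #Ш(E) ≤ ord_p q ≤ 0`, which is also
the lower half. How `q = #Ш(E)_an` is certified is lane business; NOTHING booked here.
[cite: JetchevSkinnerWan2017, §7.4.2 (p. 31)] [cite: GrossLMS1991, §2 Prop. 2.1 (2)] [cite: Miller2011LMS, Def. 1.1] -/
theorem bsdp_of_classX11b_of_ram_of_padicValRat_shaAn_le
    -- published inputs (named facts of the tree)
    (hGZ : ∀ (N : ℕ) [NeZero N] (W : WeierstrassCurve ℚ) (K : Type) [Field K] [NumberField K],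
      gross_zagier N W K)
    (hKo : ∀ (N : ℕ) [NeZero N] (W : WeierstrassCurve ℚ) (K : Type) [Field K] [NumberField K],
      kolyvagin N W K)
    (hB : ∀ (N : ℕ) [NeZero N] (W : WeierstrassCurve ℚ) (K : Type) [Field K] [NumberField K],
      Kolyvagin1990_padicValNat_card_sha_le N W K)
    (hSk : Skinner2016.thmC_padicValRat_bsd_rank_zero)
    (hGZK : rank_eq_analyticRank_of_analyticRank_le_one) (hmod : hasEntireLFunction_rat)
    (hnf : exists_isNewformOf) (hHL : HoffsteinLuo1997_exists_twist_L_one_ne_zero)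
    (hMaz : mazur_not_dvd_maninConstant_of_odd) (hNS : integral_neronScaling_of_isGloballyMinimal)
    (W : WeierstrassCurve ℚ) [W.IsElliptic] [W.IsGloballyMinimal] (p : ℕ) [Fact p.Prime]
    (hX : ClassX11b W p) (hram : Ram W p) (htam0 : ¬ p ∣ W.tamagawaProduct)
    {q : ℚ} (hq : shaAn W = (q : ℂ)) (hv : padicValRat p q ≤ 0) : BSDp W p := by
  obtain ⟨q', hq', hle⟩ := missingUpperBoundAt_of_classX11b_of_ram_of_not_dvd hGZ hKo hB hSk hGZK hmod
    hnf hHL hMaz hNS W p hX hram htam0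
  have hqq : q' = q := by exact_mod_cast hq'.symm.trans hq
  subst hqq
  have hlow : Typed.MissingLowerBoundAt W p := ⟨q', hq', by omega⟩
  exact bsdp_of_halves hGZK W p (le_of_eq hX.1) hlow ⟨q', hq', hle⟩

/-! ### `p = 3`, in the vocabulary of the typed class `IsX11Three` -/

/-- The `p = 3` clause: `IsX11Three W` (`mult(3) ∧ irr(3) ∧ r = 1`, `Rank1Residual/X11Three.lean`)
is `ClassX11b W 3`. Pure logic. [folklore] -/
theorem classX11b_three_of_isX11Three (W : WeierstrassCurve ℚ) (h : IsX11Three W) :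
    ClassX11b W 3 :=
  ⟨h.rank, by decide, h.mult, h.irr⟩

/-- **X11 at `p = 3`, rank one (`IsX11Three`), with a (ram) prime and `3 ∤ ∏c_ℓ(E)`: the
Euler-system half `ord_3 #Ш(E) ≤ ord_3 #Ш(E)_an` — UNCONDITIONAL (published named facts only).**
Kolyvagin 1990 Thm. A at `p = 3` (`ρ̄_{E,3}` onto `GL₂(𝔽₃)` from irr(3) + ram(3), Serre Prop. 15),
Skinner 2016 Thm. C at `p = 3` for the Hoffstein–Luo twist (footnote 1), Gross–Zagier, Mazur 1978
Cor. 4.1, Néron mapping property. The typed missing input of `Typed/X11Three.lean` for these pairs is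
thereby HALVED: what remains is the main-conjecture half (STEP L at `p = 3`). Census (`N < 10⁴`):
24 of the 111 `IsX11Three` pairs. Nothing booked; label unchanged (CONSTRUCTION-SHAPED).
[cite: McCallumLMS1991, §1 Theorem (Kolyvagin), p. 296] [cite: Skinner2016PacificMC, Thm. C (§1) and footnote 1]
[cite: Serre1972, §2.4 Prop. 15] [cite: HoffsteinLuo1997, Theorem (§1)] [cite: Miller2011LMS, Def. 1.1] -/
theorem IsX11Three.missingUpperBoundAt_of_ram_of_not_dvd
    -- published inputs (named facts of the tree)
    (hGZ : ∀ (N : ℕ) [NeZero N] (W : WeierstrassCurve ℚ) (K : Type) [Field K] [NumberField K],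
      gross_zagier N W K)
    (hKo : ∀ (N : ℕ) [NeZero N] (W : WeierstrassCurve ℚ) (K : Type) [Field K] [NumberField K],
      kolyvagin N W K)
    (hB : ∀ (N : ℕ) [NeZero N] (W : WeierstrassCurve ℚ) (K : Type) [Field K] [NumberField K],
      Kolyvagin1990_padicValNat_card_sha_le N W K)
    (hSk : Skinner2016.thmC_padicValRat_bsd_rank_zero)
    (hGZK : rank_eq_analyticRank_of_analyticRank_le_one) (hmod : hasEntireLFunction_rat)
    (hnf : exists_isNewformOf) (hHL : HoffsteinLuo1997_exists_twist_L_one_ne_zero)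
    (hMaz : mazur_not_dvd_maninConstant_of_odd) (hNS : integral_neronScaling_of_isGloballyMinimal)
    (W : WeierstrassCurve ℚ) [W.IsElliptic] [W.IsGloballyMinimal] (hX : IsX11Three W)
    (hram : Ram W 3) (htam0 : ¬ 3 ∣ W.tamagawaProduct) : Typed.MissingUpperBoundAt W 3 :=
  missingUpperBoundAt_of_classX11b_of_ram_of_not_dvd hGZ hKo hB hSk hGZK hmod hnf hHL hMaz hNS W 3
    (classX11b_three_of_isX11Three W hX) hram htam0

/-- **X11 at `p = 3`, rank one, with a (ram) prime (ANY Tamagawa numbers): `#Ш(E)_an = q ∈ ℚ` with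
`ord_3 #Ш(E) ≤ ord_3 q + 2·ord_3 ∏c_ℓ(E)` — UNCONDITIONAL** (Kolyvagin's Tamagawa defect at `p = 3`).
Census (`N < 10⁴`): 108 of the 111 `IsX11Three` pairs. Nothing booked.
[cite: McCallumLMS1991, §1 Theorem (Kolyvagin), p. 296] [cite: Skinner2016PacificMC, Thm. C (§1) and footnote 1]
[cite: HoffsteinLuo1997, Theorem (§1)] [cite: Miller2011LMS, Def. 1.1] -/
theorem IsX11Three.padicValNat_shaOrder_le_add_of_ram
    -- published inputs (named facts of the tree)
    (hGZ : ∀ (N : ℕ) [NeZero N] (W : WeierstrassCurve ℚ) (K : Type) [Field K] [NumberField K],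
      gross_zagier N W K)
    (hKo : ∀ (N : ℕ) [NeZero N] (W : WeierstrassCurve ℚ) (K : Type) [Field K] [NumberField K],
      kolyvagin N W K)
    (hB : ∀ (N : ℕ) [NeZero N] (W : WeierstrassCurve ℚ) (K : Type) [Field K] [NumberField K],
      Kolyvagin1990_padicValNat_card_sha_le N W K)
    (hSk : Skinner2016.thmC_padicValRat_bsd_rank_zero)
    (hGZK : rank_eq_analyticRank_of_analyticRank_le_one) (hmod : hasEntireLFunction_rat)
    (hnf : exists_isNewformOf) (hHL : HoffsteinLuo1997_exists_twist_L_one_ne_zero)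
    (hMaz : mazur_not_dvd_maninConstant_of_odd) (hNS : integral_neronScaling_of_isGloballyMinimal)
    (W : WeierstrassCurve ℚ) [W.IsElliptic] [W.IsGloballyMinimal] (hX : IsX11Three W)
    (hram : Ram W 3) :
    ∃ q : ℚ, shaAn W = (q : ℂ) ∧
      (padicValNat 3 W.shaOrder : ℤ) ≤ padicValRat 3 q + 2 * padicValNat 3 W.tamagawaProduct :=
  padicValNat_shaOrder_le_add_of_classX11b_of_ram_odd hGZ hKo hB hSk hGZK hmod hnf hHL hMaz hNS W 3
    (classX11b_three_of_isX11Three W hX) hram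

/-- **X11 at `p = 3`, rank one, with a (ram) prime and `3 ∤ ∏c_ℓ(E)`: `BSD(E,3)` from STEP L at
`p = 3`** (the route's typed input at the Manin-good Heegner data of X11b ∧ (ram) pairs) and published
facts. CONDITIONAL on STEP L (at `p = 3` further from print than at `p ≥ 5`: Castella's `p ∥ N`
`p`-adic Waldspurger formula is printed for `p ≥ 5`); nothing booked; label unchanged.
[cite: JetchevSkinnerWan2017, §7.4.1–7.4.3 (pp. 30–31)] [cite: Miller2011LMS, Def. 1.1] -/
theorem IsX11Three.bsdp_of_ram_of_not_dvd_of_indexLowerBoundAt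
    -- published inputs (named facts of the tree)
    (hGZ : ∀ (N : ℕ) [NeZero N] (W : WeierstrassCurve ℚ) (K : Type) [Field K] [NumberField K],
      gross_zagier N W K)
    (hKo : ∀ (N : ℕ) [NeZero N] (W : WeierstrassCurve ℚ) (K : Type) [Field K] [NumberField K],
      kolyvagin N W K)
    (hB : ∀ (N : ℕ) [NeZero N] (W : WeierstrassCurve ℚ) (K : Type) [Field K] [NumberField K],
      Kolyvagin1990_padicValNat_card_sha_le N W K)
    (hSk : Skinner2016.thmC_padicValRat_bsd_rank_zero)
    (hGZK : rank_eq_analyticRank_of_analyticRank_le_one) (hmod : hasEntireLFunction_rat)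
    (hnf : exists_isNewformOf) (hHL : HoffsteinLuo1997_exists_twist_L_one_ne_zero)
    (hMaz : mazur_not_dvd_maninConstant_of_odd) (hNS : integral_neronScaling_of_isGloballyMinimal)
    (hL : ∀ (W : WeierstrassCurve ℚ) [W.IsElliptic] [W.IsGloballyMinimal] (p : ℕ) [Fact p.Prime]
      (N : ℕ) [NeZero N] (K : Type) [Field K] [NumberField K]
      (Dt : ModularParametrizationData W N) (H : HeegnerDatum N (NumberField.discr K)) (ι : K →+* ℂ)
      (P : (W.baseChange K).toAffine.Point),
      ClassX11b W p → Ram W p → W.conductorNorm ℤ = N → IsImaginaryQuadratic K →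
      SatisfiesHeegnerHypothesis N K →
      WeierstrassCurve.Affine.Point.map ι.toRatAlgHom P = heegnerPointComplex Dt H →
      ¬ (p : ℤ) ∣ Dt.c → IndexLowerBoundAt W p K P)
    (W : WeierstrassCurve ℚ) [W.IsElliptic] [W.IsGloballyMinimal] (hX : IsX11Three W)
    (hram : Ram W 3) (htam0 : ¬ 3 ∣ W.tamagawaProduct) : BSDp W 3 :=
  bsdp_of_classX11b_of_ram_of_not_dvd hGZ hKo hB hSk hGZK hmod hnf hHL hMaz hNS hL W 3
    (classX11b_three_of_isX11Three W hX) hram htam0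

end Summit.BirchSwinnertonDyer.Rank1Residual.X11b

end
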